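import Summits.AtomisticToContinuum.BoseEinsteinCondensation.Theses.BECNudgeWalk

/-!
# Birth skeleton — crux `NudgedCondensation` (route `BECNudgeWalk`, item stmt-AtomisticToContinuum-14362)

Line `birth` (skeleton-register, BC3).  The crux is the RUNG of the nudge walk:
for every repulsive finite-range `v` and all `τ, θ > 0`, at small density and for all large `N`
(`L = (N/ρ)^{1/3}`, `s = θρa`, `a = (scatteringLength v).toReal`)

  `R(s) := inf_Ψ (⟨Ψ,HΨ⟩ + s·(N − n₀(Ψ))) ≤ E₀^D(N,L) + s·τ·N`.

It is cut along its two genuine halves (the proof route recorded in the route file, § crux #5):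

* `stub_lowerBoundTL` — the Lieb–Yngvason lower bound for the DIRICHLET ground-state energy in
  thermodynamic-limit form: `E₀^D(N, (N/ρ)^{1/3}) ≥ 4πρa(1−η)N` for `ρ < ρ₀(v,η)` and all large `N`
  (from the in-tree finite-box fact `LSSY2005_lowerBound_dirichlet_holds`, LSSY2005 Thm 2.4 (2.35):
  choose `Y = 4πρa³/3` so small that `C·Y^{1/17} ≤ η`, then `N` so large that
  `L/a > C'·Y^{-6/17}`; `N/L³ = ρ` by `div_sideLength_pow_three`).  Size S/M.
* `stub_condensedTrial` — the CONDENSED DIRICHLET TRIAL STATE (the new, unprinted half): for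
  `a > 0` and every `η > 0`, at small density and for all large `N` there is an admissible
  (C¹, Bose-symmetric, Dirichlet) `Ψ` in the box of side `(N/ρ)^{1/3}` with
  `⟨Ψ,HΨ⟩ ≤ 4πρa(1+η)N` AND flat-mode occupation `n₀(Ψ) = ⟨φ₀,γ_Ψ φ₀⟩ ≥ (1−η)N`,
  `φ₀ = constantMode L`.  Intended witness: the periodic Jastrow product `∏_{i<j} Φ(xᵢ−xⱼ)` of
  `LSSY2005_jastrowBound_holds` / `LSSY2005_dysonProfile_holds` (energy `≤ 4πρ′a(1+12a/b)N` on the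
  torus of side `L·M/(M+1)`) multiplied by the smooth partition-of-unity cut-off of
  `exists_dirichlet_le_periodic` (BastiCenatiempoSchlein2021 Lemma A.1: factor `1+4/M` plus
  `C·N·M/L²`), whose flat-mode fraction is `≥ (1 − 6/M − (N−1)∫(1−Φ)/L³)²` by the pointwise bound
  `∫_Λ Ψ(x,X′)dx ≥ G(X′)(L³ − (N−1)∫(1−Φ) − |slabs|)`, `∫_Λ Ψ(x,X′)² dx ≤ G(X′)² L³`
  (`0 ≤ Φ ≤ 1`); take `M = ⌊√L⌋`, `a/b → 0` with `ρ`.  Size M/L — the load-bearing stub.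

`NudgedCondensation_of_stubs : StubA → StubB → NudgedCondensation` is the kernel-checked assembly
(real proof, no `sorry`, axioms propext/choice/Quot.sound), and `NudgedCondensation_of :
NudgedCondensation` composes it with the two stubs BY NAME (registered form).  For `a = 0` the
nudge vanishes (`s = 0`) and `R(0) = E₀^D`; for `a > 0` evaluate the nudged functional at the stub's
trial state with `η = min(1/2, θτ/(8π+θ))`: `R(s) ≤ 4πρa(1+η)N + s·ηN ≤ 4πρa(1−η)N + sτN ≤ E₀^D + sτN`
because `η(8π + θ) ≤ θτ` — all in `ℝ≥0∞` with the truncated subtraction `N − n₀(Ψ) ≤ ηN`.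

Disproof used: none on file for this crux (`ledger crux ls` shows no `Disproof.lean`; the sub's
only negative, SwapJensen stmt-3980, is not touched).  Sorries: exactly the two `stub_*`.
-/

namespace Summit.AtomisticToContinuum.BoseEinsteinCondensation.Cruxes.NudgedCondensation.Birth

open Literature.MathematicalPhysics.QuantumManyBody.BoseGas
open Summit.AtomisticToContinuum.BoseEinsteinCondensation.Theses.BECNudgeWalk (NudgedCondensation)

/-- **Stub A (Lieb–Yngvason lower bound, thermodynamic-limit form).** For repulsive finite-range `v`
with finite scattering length `a` and every `η > 0` there is `ρ₀ > 0` such that for `0 < ρ < ρ₀` and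
all large `N`: `E₀^D(N, (N/ρ)^{1/3}) ≥ 4πρa(1−η)N`.  [LSSY2005 Thm 2.4 (2.35), via
`LSSY2005_lowerBound_dirichlet_holds` + `div_sideLength_pow_three`; trivially true when `a = 0`.] -/
theorem stub_lowerBoundTL :
    ∀ v : ℝ → ENNReal, IsRepulsiveFiniteRange v → scatteringLength v ≠ ⊤ →
      ∀ η : ℝ, 0 < η → ∃ ρ₀ : ℝ, 0 < ρ₀ ∧ ∀ ρ : ℝ, 0 < ρ → ρ < ρ₀ →
        ∀ᶠ N : ℕ in Filter.atTop,
          ENNReal.ofReal (4 * Real.pi * ρ * (scatteringLength v).toReal * (1 - η) * N) ≤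
            groundStateEnergy v N (sideLength ρ N) := by
  sorry

/-- **Stub B (condensed Dirichlet trial state; load-bearing).** For repulsive finite-range `v` with
`a = (scatteringLength v).toReal > 0` and every `η > 0` there is `ρ₀ > 0` such that for `0 < ρ < ρ₀`
and all large `N` some admissible Dirichlet trial state `Ψ` in the box of side `L = (N/ρ)^{1/3}` has
energy `≤ 4πρa(1+η)N` and flat-mode occupation `⟨φ₀, γ_Ψ φ₀⟩ ≥ (1−η)N` (`φ₀ = constantMode L`).
[Jastrow product of LSSY2005 Thm 2.2 / Dyson1957 (`LSSY2005_jastrowBound_holds`,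
`LSSY2005_dysonProfile_holds`) localised by BastiCenatiempoSchlein2021 Lemma A.1
(`exists_dirichlet_le_periodic`, re-run on the explicit cut-off state); occupation by the pointwise
product bound — not in print.] -/
theorem stub_condensedTrial :
    ∀ v : ℝ → ENNReal, IsRepulsiveFiniteRange v → 0 < (scatteringLength v).toReal →
      ∀ η : ℝ, 0 < η → ∃ ρ₀ : ℝ, 0 < ρ₀ ∧ ∀ ρ : ℝ, 0 < ρ → ρ < ρ₀ →
        ∀ᶠ N : ℕ in Filter.atTop,
          ∃ Ψ : TrialState N (sideLength ρ N),
            energy v Ψ ≤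
                ENNReal.ofReal (4 * Real.pi * ρ * (scatteringLength v).toReal * (1 + η) * N) ∧
              ENNReal.ofReal ((1 - η) * N) ≤
                occupation N (constantMode (sideLength ρ N)) Ψ.ψ := by
  sorry

/-- **Assembly, implication form (kernel-checked, axioms `propext`/`Classical.choice`/`Quot.sound`
only).** Stub A → Stub B → the crux `NudgedCondensation` BY NAME. -/
theorem NudgedCondensation_of_stubs :
    (∀ v : ℝ → ENNReal, IsRepulsiveFiniteRange v → scatteringLength v ≠ ⊤ →
      ∀ η : ℝ, 0 < η → ∃ ρ₀ : ℝ, 0 < ρ₀ ∧ ∀ ρ : ℝ, 0 < ρ → ρ < ρ₀ →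
        ∀ᶠ N : ℕ in Filter.atTop,
          ENNReal.ofReal (4 * Real.pi * ρ * (scatteringLength v).toReal * (1 - η) * N) ≤
            groundStateEnergy v N (sideLength ρ N)) →
    (∀ v : ℝ → ENNReal, IsRepulsiveFiniteRange v → 0 < (scatteringLength v).toReal →
      ∀ η : ℝ, 0 < η → ∃ ρ₀ : ℝ, 0 < ρ₀ ∧ ∀ ρ : ℝ, 0 < ρ → ρ < ρ₀ →
        ∀ᶠ N : ℕ in Filter.atTop,
          ∃ Ψ : TrialState N (sideLength ρ N),
            energy v Ψ ≤
                ENNReal.ofReal (4 * Real.pi * ρ * (scatteringLength v).toReal * (1 + η) * N) ∧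
              ENNReal.ofReal ((1 - η) * N) ≤
                occupation N (constantMode (sideLength ρ N)) Ψ.ψ) →
    NudgedCondensation := by
  intro hA hB v hv τ θ hτ hθ
  rcases (ENNReal.toReal_nonneg : 0 ≤ (scatteringLength v).toReal).eq_or_lt with ha | ha
  · -- `a = 0`: the nudge `s = θρa` vanishes and `R(0) = E₀^D` by definition of the ground-state energy.
    refine ⟨1, one_pos, fun ρ _ _ => Filter.Eventually.of_forall fun N => ?_⟩
    simp [← ha, groundStateEnergy]
  · -- `a > 0`: evaluate the nudged functional at the condensed trial state of Stub B.
    have hatop : scatteringLength v ≠ ⊤ := (ENNReal.toReal_pos_iff.mp ha).2.ne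
    have h8 : 0 < 8 * Real.pi + θ := by positivity
    -- the tolerance `η = min (1/2) (θτ/(8π+θ))`
    obtain ⟨η, hη, hη1, hη2⟩ : ∃ η : ℝ, 0 < η ∧ η ≤ 1 / 2 ∧ η * (8 * Real.pi + θ) ≤ θ * τ := by
      refine ⟨min (1 / 2) (θ * τ / (8 * Real.pi + θ)), lt_min (by norm_num) (by positivity),
        min_le_left _ _, ?_⟩
      calc min (1 / 2) (θ * τ / (8 * Real.pi + θ)) * (8 * Real.pi + θ)
          ≤ θ * τ / (8 * Real.pi + θ) * (8 * Real.pi + θ) :=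
            mul_le_mul_of_nonneg_right (min_le_right _ _) h8.le
        _ = θ * τ := div_mul_cancel₀ _ h8.ne'
    obtain ⟨ρ₁, hρ₁, H1⟩ := hA v hv hatop η hη
    obtain ⟨ρ₂, hρ₂, H2⟩ := hB v hv ha η hη
    refine ⟨min ρ₁ ρ₂, lt_min hρ₁ hρ₂, fun ρ hρ hρlt => ?_⟩
    filter_upwards [H1 ρ hρ (hρlt.trans_le (min_le_left _ _)),
      H2 ρ hρ (hρlt.trans_le (min_le_right _ _))] with N hlow hΨ
    obtain ⟨Ψ, hE, hocc⟩ := hΨ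
    dsimp only
    set a : ℝ := (scatteringLength v).toReal with ha_def
    -- depletion of the trial state in the flat mode: `N − n₀(Ψ) ≤ ηN` (truncated subtraction)
    have hdep : (N : ENNReal) - occupation N (constantMode (sideLength ρ N)) Ψ.ψ ≤
        ENNReal.ofReal (η * N) := by
      refine tsub_le_iff_right.mpr ?_
      calc (N : ENNReal) = ENNReal.ofReal (η * N + (1 - η) * N) := by
            rw [← ENNReal.ofReal_natCast]; congr 1; ring
        _ ≤ ENNReal.ofReal (η * N) + ENNReal.ofReal ((1 - η) * N) := ENNReal.ofReal_add_le
        _ ≤ ENNReal.ofReal (η * N) + occupation N (constantMode (sideLength ρ N)) Ψ.ψ :=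
            add_le_add le_rfl hocc
    have hs : 0 ≤ θ * ρ * a := by positivity
    have h1η : 0 ≤ 1 - η := by linarith
    have hlow' : 0 ≤ 4 * Real.pi * ρ * a * (1 - η) * N :=
      mul_nonneg (mul_nonneg (by positivity) h1η) (Nat.cast_nonneg N)
    -- the real-number budget: `4πρa(1+η)N + s·ηN ≤ 4πρa(1−η)N + s·τ·N` since `η(8π+θ) ≤ θτ`
    have hreal : 4 * Real.pi * ρ * a * (1 + η) * N + θ * ρ * a * (η * N) ≤
        4 * Real.pi * ρ * a * (1 - η) * N + θ * ρ * a * τ * N := by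
      have key : 0 ≤ ρ * a * N * (θ * τ - η * (8 * Real.pi + θ)) :=
        mul_nonneg (by positivity) (sub_nonneg.mpr hη2)
      have expand : (4 * Real.pi * ρ * a * (1 - η) * N + θ * ρ * a * τ * N) -
          (4 * Real.pi * ρ * a * (1 + η) * N + θ * ρ * a * (η * N)) =
          ρ * a * N * (θ * τ - η * (8 * Real.pi + θ)) := by ring
      rw [← expand] at key
      exact sub_nonneg.mp key
    calc (⨅ Φ : TrialState N (sideLength ρ N), (energy v Φ + ENNReal.ofReal (θ * ρ * a) *
            ((N : ENNReal) - occupation N (constantMode (sideLength ρ N)) Φ.ψ)))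
        ≤ energy v Ψ + ENNReal.ofReal (θ * ρ * a) *
            ((N : ENNReal) - occupation N (constantMode (sideLength ρ N)) Ψ.ψ) :=
          iInf_le _ Ψ
      _ ≤ ENNReal.ofReal (4 * Real.pi * ρ * a * (1 + η) * N) +
            ENNReal.ofReal (θ * ρ * a) * ENNReal.ofReal (η * N) :=
          add_le_add hE (by gcongr)
      _ = ENNReal.ofReal (4 * Real.pi * ρ * a * (1 + η) * N + θ * ρ * a * (η * N)) := by
          rw [← ENNReal.ofReal_mul hs, ← ENNReal.ofReal_add (by positivity) (by positivity)]
      _ ≤ ENNReal.ofReal (4 * Real.pi * ρ * a * (1 - η) * N + θ * ρ * a * τ * N) :=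
          ENNReal.ofReal_le_ofReal hreal
      _ = ENNReal.ofReal (4 * Real.pi * ρ * a * (1 - η) * N) + ENNReal.ofReal (θ * ρ * a * τ * N) :=
          ENNReal.ofReal_add hlow' (by positivity)
      _ ≤ groundStateEnergy v N (sideLength ρ N) + ENNReal.ofReal (θ * ρ * a * τ * N) :=
          add_le_add hlow le_rfl

/-- **Composition (registered form).** The crux `NudgedCondensation` BY NAME from the two declared
stubs BY NAME — no `sorry` of its own; its only `sorryAx` ancestry is `stub_lowerBoundTL`,
`stub_condensedTrial`. -/
theorem NudgedCondensation_of : NudgedCondensation :=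
  NudgedCondensation_of_stubs stub_lowerBoundTL stub_condensedTrial

end Summit.AtomisticToContinuum.BoseEinsteinCondensation.Cruxes.NudgedCondensation.Birth
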